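import Literature.NumberTheory.Transcendental.RoySmallValueBasic
import Literature.NumberTheory.Transcendental.ChudnovskyHeights
import Mathlib.Algebra.Polynomial.Taylor
import Mathlib.Algebra.Polynomial.AlgebraMap
import HarnessLib

/-!
# Roy's small value estimate for `𝔾ₐ × 𝔾ₘ` — polynomials in `𝒟` acting on monomials (§3, proof of Prop. 3.3)

Topic `Literature/NumberTheory/Transcendental`. Third instalment of the formalisation of the proof
of Roy 2013, Theorem 1.1 (named fact `roy2013_thm_1_1`, `RoySmallValueEstimates.lean`), after
`RoySmallValueBasic.lean` (`𝒟 = homD`, `τ_γ = tau`, Lemma 3.1). This file is the operator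
calculus behind the proof of **Proposition 3.3** of D. Roy, *A small value estimate for
`𝔾ₐ × 𝔾ₘ`*, Mathematika 59 (2013) 333–363 = arXiv:1301.0663, §3 (pp. 8–9 of the arXiv text).

Roy considers, for a monomial `M = X₀^{ν₀} X₁^{j} X₂^{k}`, the sequence
`u_i = 𝒟^i M(1, 0, 1)` and shows `(τ - k)^r u = j(j-1)⋯(j-r+1) u'` for the shifted monomial
(his (3.2)), whence `((τ - k)^r u)_0 = r! δ_{j,r}` (his (3.3)), and then applies a polynomial
`b(τ)` in the shift `τ`. We phrase this directly with the operator `b(𝒟) = Polynomial.aeval 𝒟 b`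
(`𝒟` as an element of the `ℂ`-algebra `Module.End ℂ ℂ[X]`), which is the same thing since
`(b(τ)u)_0 = (b(𝒟)M)(1, 0, 1)`:

* `end_sub_pow_monomial` — `(𝒟 - k)^n (c X^ν) = c · ν₁(ν₁-1)⋯(ν₁-n+1) · X^{ν + n e₀ - n e₁}`
  for `k = ν₂` (Roy's (3.2));
* `aeval_e_end_sub_pow_monomial` — `((𝒟 - ν₂)^n (c X^ν))(1, 0, 1) = c ν₁! δ_{n, ν₁}` (Roy's (3.3));
* `aeval_e_polyD_monomial` — for every `f ∈ ℂ[Y]`: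
  `(f(𝒟)(c X^ν))(1, 0, 1) = c · ν₁! · [Y^{ν₁}] f(Y + ν₂)`, the `ν₁`-th Taylor coefficient of `f`
  at `ν₂` (combine (3.3) with Taylor's formula `f = ∑ₙ [Yⁿ]f(Y + k) · (Y - k)ⁿ`);
* `norm_aeval_polyD_le` — `|(f(𝒟)Q)(1, γ)| ≤ 𝓛(f) · max_{n ≤ deg f} |𝒟ⁿQ(1, γ)|`, the trivial
  estimate used at the end of the proof of Proposition 3.3 (`|q_{r,s}| ≤ 𝓛(b) max |u_i|`).

The length `𝓛` of a univariate polynomial is the tree's `Chudnovsky.pwnorm (normRingSeminorm ℂ)`.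
Everything here is proved; no definitions, no new named facts.

## References

* [Roy2013] D. Roy, *A small value estimate for 𝔾ₐ × 𝔾ₘ*, Mathematika 59 (2013), 333–363
  (arXiv:1301.0663), §3, proof of Proposition 3.3, formulas (3.2)–(3.3).
-/

noncomputable section

open MvPolynomial
open scoped Polynomial

namespace Literature.NumberTheory.Transcendental

namespace Roy2013

open Nesterenko Chudnovsky

/-! ### One step: `𝒟 - ν₂` on `c X^ν` -/

/-- `(𝒟 - ν₂)(c X^ν) = c ν₁ X^{ν + e₀ - e₁}`. [cite: Roy2013, §3, (3.2)] -/
theorem homD_sub_smul_monomial (ν : Fin 3 →₀ ℕ) (c : ℂ) :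
    homD (monomial ν c) - (ν 2 : ℂ) • monomial ν c =
      monomial (Finsupp.single 0 1 + (ν - Finsupp.single 1 1)) (c * ν 1) := by
  rw [homD_monomial, smul_monomial, smul_eq_mul, mul_comm (ν 2 : ℂ) c, add_sub_cancel_right]

/-- The three coordinates of the shifted exponent `n e₀ + (ν - n e₁)`. [folklore] -/
theorem shift_apply_zero (ν : Fin 3 →₀ ℕ) (n : ℕ) :
    (Finsupp.single 0 n + (ν - Finsupp.single 1 n) : Fin 3 →₀ ℕ) 0 = n + ν 0 := by
  simp

/-- See `shift_apply_zero`. [folklore] -/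
theorem shift_apply_one (ν : Fin 3 →₀ ℕ) (n : ℕ) :
    (Finsupp.single 0 n + (ν - Finsupp.single 1 n) : Fin 3 →₀ ℕ) 1 = ν 1 - n := by
  simp

/-- See `shift_apply_zero`. [folklore] -/
theorem shift_apply_two (ν : Fin 3 →₀ ℕ) (n : ℕ) :
    (Finsupp.single 0 n + (ν - Finsupp.single 1 n) : Fin 3 →₀ ℕ) 2 = ν 2 := by
  simp

/-- Shifting once more: `e₀ + ((n e₀ + (ν - n e₁)) - e₁) = (n+1) e₀ + (ν - (n+1) e₁)` (with
truncated subtraction of exponents). [folklore] -/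
theorem shift_shift (ν : Fin 3 →₀ ℕ) (n : ℕ) :
    (Finsupp.single 0 1 +
        ((Finsupp.single 0 n + (ν - Finsupp.single 1 n)) - Finsupp.single 1 1) : Fin 3 →₀ ℕ) =
      Finsupp.single 0 (n + 1) + (ν - Finsupp.single 1 (n + 1)) := by
  ext i
  fin_cases i
  · simp; omega
  · simp; omega
  · simp

/-! ### Iteration: `(𝒟 - ν₂)^n` on `c X^ν` (Roy's (3.2)) -/

/-- **Roy 2013, (3.2)** in operator form: for `k = ν₂`,
`(𝒟 - k)^n (c X^ν) = c · ν₁(ν₁-1)⋯(ν₁-n+1) · X^{n e₀ + ν - n e₁}` (both sides vanish for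
`n > ν₁`). Here `𝒟` is viewed in the `ℂ`-algebra `Module.End ℂ ℂ[X]`. [cite: Roy2013, §3, (3.2)] -/
theorem end_sub_pow_monomial (ν : Fin 3 →₀ ℕ) (c : ℂ) (n : ℕ) :
    (((homD : CX →ₗ[ℂ] CX) - algebraMap ℂ (Module.End ℂ CX) (ν 2 : ℂ)) ^ n) (monomial ν c) =
      monomial (Finsupp.single 0 n + (ν - Finsupp.single 1 n)) (c * (ν 1).descFactorial n) := by
  induction n with
  | zero => simp
  | succ n ih =>
    rw [pow_succ', Module.End.mul_apply, ih, LinearMap.sub_apply, Module.algebraMap_end_apply,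
      Derivation.coeFn_coe]
    have h2 := homD_sub_smul_monomial (Finsupp.single 0 n + (ν - Finsupp.single 1 n))
      (c * (ν 1).descFactorial n)
    rw [shift_apply_two, shift_apply_one] at h2
    rw [h2, shift_shift ν n]
    by_cases hn : n < ν 1
    · rw [Nat.descFactorial_succ, Nat.cast_mul, Nat.cast_sub hn.le]
      ring_nf
    · have h0 : ν 1 - n = 0 := by omega
      have h0' : (ν 1).descFactorial (n + 1) = 0 := Nat.descFactorial_eq_zero_iff_lt.mpr (by omega)
      simp only [h0, h0', Nat.cast_zero, mul_zero, monomial_zero]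

/-! ### Evaluation at `e = (0, 1)`, i.e. at the point `(1, 0, 1)` -/

/-- `(c X^μ)(1, 0, 1) = c` if `μ₁ = 0` and `0` otherwise. [cite: Roy2013, §3 (proof of Prop. 3.3)] -/
theorem aeval_e_monomial (μ : Fin 3 →₀ ℕ) (c : ℂ) :
    aeval ![(1 : ℂ), 0, 1] (monomial μ c) = if μ 1 = 0 then c else 0 := by
  rw [aeval_monomial, Finsupp.prod_fintype _ _ (fun i => by simp), Fin.prod_univ_three]
  simp only [Algebra.algebraMap_self, RingHom.id_apply, Matrix.cons_val_zero, one_pow,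
    Matrix.cons_val_one, Matrix.cons_val, mul_one, zero_pow_eq, mul_ite, mul_zero]

/-- **Roy 2013, (3.3)** in operator form: `((𝒟 - ν₂)^n (c X^ν))(1, 0, 1) = c · ν₁! · δ_{n, ν₁}`.
[cite: Roy2013, §3, (3.3)] -/
theorem aeval_e_end_sub_pow_monomial (ν : Fin 3 →₀ ℕ) (c : ℂ) (n : ℕ) :
    aeval ![(1 : ℂ), 0, 1]
        ((((homD : CX →ₗ[ℂ] CX) - algebraMap ℂ (Module.End ℂ CX) (ν 2 : ℂ)) ^ n) (monomial ν c)) =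
      if n = ν 1 then c * (ν 1).factorial else 0 := by
  rw [end_sub_pow_monomial, aeval_e_monomial, shift_apply_one]
  rcases lt_trichotomy n (ν 1) with h | rfl | h
  · rw [if_neg (by omega), if_neg h.ne]
  · rw [if_pos (Nat.sub_self _), if_pos rfl, Nat.descFactorial_self]
  · rw [if_pos (by omega), if_neg h.ne', Nat.descFactorial_eq_zero_iff_lt.mpr h, Nat.cast_zero,
      mul_zero]

/-! ### A polynomial in `𝒟` on a monomial, evaluated at `(1, 0, 1)` -/

/-- `f(𝒟)` for `f = a (Y - k)^i`: `a · (𝒟 - k)^i`. [folklore] -/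
theorem polyD_C_mul_X_sub_C_pow (a k : ℂ) (i : ℕ) :
    Polynomial.aeval (homD : CX →ₗ[ℂ] CX) (Polynomial.C a * (Polynomial.X - Polynomial.C k) ^ i) =
      a • ((homD : CX →ₗ[ℂ] CX) - algebraMap ℂ (Module.End ℂ CX) k) ^ i := by
  rw [map_mul, Polynomial.aeval_C, map_pow, map_sub, Polynomial.aeval_X, Polynomial.aeval_C,
    Algebra.smul_def]

/-- **Taylor-coefficient formula**: for every `f ∈ ℂ[Y]`,
`(f(𝒟)(c X^ν))(1, 0, 1) = c · ν₁! · [Y^{ν₁}] f(Y + ν₂)`. (Roy's (3.3) summed against Taylor's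
formula `f = ∑ₙ [Yⁿ]f(Y + ν₂) · (Y - ν₂)ⁿ`.) [cite: Roy2013, §3, proof of Proposition 3.3] -/
theorem aeval_e_polyD_monomial (f : ℂ[X]) (ν : Fin 3 →₀ ℕ) (c : ℂ) :
    aeval ![(1 : ℂ), 0, 1] (Polynomial.aeval (homD : CX →ₗ[ℂ] CX) f (monomial ν c)) =
      c * (ν 1).factorial * (Polynomial.taylor (ν 2 : ℂ) f).coeff (ν 1) := by
  classical
  conv_lhs => rw [← Polynomial.sum_taylor_eq f (ν 2 : ℂ)]
  rw [Polynomial.sum_def, map_sum, LinearMap.sum_apply, map_sum]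
  simp_rw [polyD_C_mul_X_sub_C_pow, LinearMap.smul_apply, map_smul, aeval_e_end_sub_pow_monomial,
    smul_eq_mul, mul_ite, mul_zero]
  rw [Finset.sum_ite_eq']
  split_ifs with h
  · ring
  · rw [Polynomial.notMem_support_iff.mp h, mul_zero]

/-! ### The trivial estimate `|(f(𝒟)Q)(1, γ)| ≤ 𝓛(f) · max |𝒟ⁿQ(1, γ)|` -/

/-- `f(𝒟) Q = ∑ₙ fₙ 𝒟ⁿ Q`. [folklore] -/
theorem polyD_apply_eq_sum (f : ℂ[X]) (Q : CX) :
    Polynomial.aeval (homD : CX →ₗ[ℂ] CX) f Q =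
      ∑ n ∈ Finset.range (f.natDegree + 1), f.coeff n • homD^[n] Q := by
  rw [Polynomial.aeval_eq_sum_range, LinearMap.sum_apply]
  refine Finset.sum_congr rfl fun n _ => ?_
  rw [LinearMap.smul_apply, Module.End.pow_apply, Derivation.coeFn_coe]

/-- **The estimate closing the proof of Proposition 3.3**: if `|𝒟ⁿ Q(1, ξ, η)| ≤ B` for all
`n ≤ deg f`, then `|(f(𝒟) Q)(1, ξ, η)| ≤ 𝓛(f) B`. [cite: Roy2013, §3, proof of Proposition 3.3] -/
theorem norm_aeval_polyD_le (f : ℂ[X]) (Q : CX) (ξ η : ℂ) {B : ℝ}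
    (hB : ∀ n ≤ f.natDegree, ‖aeval ![1, ξ, η] (homD^[n] Q)‖ ≤ B) :
    ‖aeval ![1, ξ, η] (Polynomial.aeval (homD : CX →ₗ[ℂ] CX) f Q)‖ ≤
      pwnorm (normRingSeminorm ℂ) f * B := by
  rw [polyD_apply_eq_sum, map_sum, pwnorm_eq_sum_range, Finset.sum_mul]
  refine (norm_sum_le _ _).trans (Finset.sum_le_sum fun n hn => ?_)
  rw [map_smul, smul_eq_mul, norm_mul]
  exact mul_le_mul_of_nonneg_left (hB n (Nat.lt_succ_iff.mp (Finset.mem_range.mp hn)))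
    (norm_nonneg _)

end Roy2013

end Literature.NumberTheory.Transcendental
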